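import Summits.QuantumFields.BalabanUV.T4Continuum.Spine.NE7.QLaBlockAvgTwoLevelFramed
import Summits.QuantumFields.BalabanUV.T4Continuum.Spine.NE7.QLaBlockAvgContraction

/-!
# Spine/NE7/QLaBlockAvgTwoLevelContraction — `BondDevBound` ∕ `HolDevBound` ∕ `LoopDefectBound` for the TWO-LEVEL printed prescription
# [Balaban1987RG1] (0.10)–(0.12) `blockAvg₂ federbushSU expMeanLogSU` on `SU(N)`, and NODE S's holonomy-level input FOR THE WHOLE PRINTED
# CLASS `IsPrintedAveraged` OF THE HEADLINE (both disjuncts), rate `θ = L^{1−d}`, constant `e`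

Cell `pub-balaban-gaps` (YM blitz Y1, track G2, seat `ne7`, generation 8; proposed by generation 9 with the DOMAIN-KIND note below); text of record
`run/shared/lean/pub/pub-balaban-gaps/ne/NE7.md` v9.2, census rows R55 (→ A) and R61.  Sequel of `QLaBlockAvgTwoLevelFramed` (the per-bond estimate) and `QLaBlockAvgContraction` (the one-level tower):
§1 sums the per-bond estimate over the coarse bonds (`tv_framed₂_le`: `tv(1, F₂(V)) ≤ (θ + K₂ρ)·tv(1,V)`, `K₂ = 46956·d·|S_d|²·ℓ²`); §2 the
shrinking sup-ball domains `dom₂` (radius ratio `71|S_d|ℓ`, top radius `min(δ_Fed/(4ℓ), δ_N/(48|S_d|ℓ), θ/(2K₂))`); §3 the tower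
(`flatStepContraction_blockAvg₂SU`, `bondDevBound_blockAvg₂SU`, `holDevBound_blockAvg₂SU`, `loopDefectBound_blockAvg₂SU`); §4 the corollaries
for the headline's classes: `holDevBound_of_isPrintedAveraged₂` and, on the intersection of the two domain families,
**`holDevBound_of_isPrintedAveraged`** ∕ **`loopDefectBound_of_isPrintedAveraged`** for EVERY `D : FiniteEpsData F SU(N)` with `D.IsPrintedAveraged` —
the exact hypothesis of `T4ContinuumYM4Torus.continuumYM4_torus_of_BetaPertH`.

DOMAIN KIND (generation 9, census R61 — located self-correction of `QLaBlockAvgContraction.rad`'s docstring sentence «of the KIND of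
[Balaban1985Averaging] (158)» and of census v8 R54).  [Balaban1985Averaging] (158) p. 42 is `‖U − U₀‖ = ‖UU₀⁻¹ − 1‖ < α₁η` with `η = L^{−n}`
for `n` levels below the top: radius ∝ `L^{−n}`, i.e. a connection amplitude `‖A′‖ < α₁` UNIFORM in the depth (the B7-(15) torus chain of
`QLaTorusFramedBondLip` has this kind: `ρ_k ∝ L^{−(m+K−k)}`).  The domains HERE are NOT of that kind: `rad P n j = ρ⋆·(16ℓ)^{−(m+K−j)}` (one
level) and `rad₂ P n j = ρ⋆₂·(71·|S_d|·ℓ)^{−(m+K−j)}` (two levels) shrink per level by `16ℓ = 160·L` resp. `71·|S_d|·ℓ = 17040·L` at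
`(d, L) = (4, 3)`, so in amplitude units the admitted fields decay like `160^{−n}` resp. `17040^{−n}` with the depth — SMALLER IN KIND than
(158), because the one-step sup-Lipschitz constant of the framed map (`dist1_framed_le_sup`, `dist1_framed₂_le_sup`) is paid at EVERY
level, whereas Prop. 5 (156) bounds the COMPOSED k-fold averaging k-uniformly.  Hence: the corollaries below inhabit `HolDevBound` ∕
`LoopDefectBound` for the headline's printed class with the contracting rate `θ = L^{1−d}` ON THESE DOMAINS (non-vacuity); on print-kind
domains (amplitude uniform in depth) NODE S's input for (0.4) ∕ (0.10)–(0.12) still leans on a k-uniform bound for the COMPOSED printed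
averaging (pub-balaban row O3c's NE1a ∕ the tree dictionary «(0.4)-as-typed = (15)-as-typed») — not supplied here.

HONEST FRAMING.  Flat-reference form only (NOT NE1a-STEP, NOT Props 3–5, NOT (52)/(158) — neither verbatim nor in kind; OUR domains); nothing of
Bałaban's densities, R-operation or (1.100) insert.  (QL-a) NOT IN PRINT ([Balaban1989LargeFieldII] p. 356); NE7 NOT proved; spine 0∕9; fixed finite T⁴ — NOT ℝ⁴,
NOT infinite volume, NOT a mass gap, NOT Clay.
-/

noncomputable section
open Finset
open scoped BigOperators Matrix Matrix.Norms.L2Operator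

namespace Summit.QuantumFields.BalabanUV.T4Continuum.Spine.NE7

open Literature.MathematicalPhysics.QuantumFieldTheory.Balaban1983to89
open Literature.MathematicalPhysics.QuantumFieldTheory.Balaban1983to89.T4Continuum
open Literature.MathematicalPhysics.QuantumFieldTheory.Balaban1983to89.T4AvgSensitivity
open Literature.MathematicalPhysics.QuantumFieldTheory.Balaban1983to89.T4AvgDerivBound
open Literature.MathematicalPhysics.QuantumFieldTheory.Balaban1983to89.BlockAveraging (Idx off loopHol blockOf_src_of_mem_walk)
open Literature.MathematicalPhysics.QuantumFieldTheory.Balaban1983to89.BlockAveragingTwoLevel (Pt stairHol cVar cVarRev seg loopHol₂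
  Small₂ corr₂ avgFun₂ blockAvg₂ blockAvg₂_avg)
open Literature.MathematicalPhysics.QuantumFieldTheory.Balaban1983to89.AveragingRT (axialAvg)
open ExpMeanLog FederbushMean

section SUN

variable {n : Type*} [Fintype n] [DecidableEq n] [Nonempty n]
variable {P : Params} {j : ℕ}

/-! ## §1 Summing the per-bond estimate over the coarse bonds -/

/-- `|Pt| = L^d`. [folklore] -/
theorem card_pt (P : Params) : (Fintype.card (Pt P) : ℝ) = (P.L : ℝ) ^ P.d := by
  rw [Fintype.card_fun, Fintype.card_fin, Fintype.card_fin]; push_cast; ring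

/-- THE COLUMN BOUND in the two-level indexing: `Σ_c |Pt|⁻¹Σ_r mass([x_r, x_r′]) ≤ θ·tv(1,V)`. [folklore] -/
theorem sum_mean_segMass₁_le (hj : j + 1 ≤ P.m + P.K) (V : GaugeField P j (Matrix.specialUnitaryGroup n ℂ)) :
    ∑ c : PBond P (j + 1), (Fintype.card (Pt P) : ℝ)⁻¹ * ∑ r : Pt P, segMass₁ V c r ≤ theta P * tv 1 V := by
  have hL : (0 : ℝ) < (P.L : ℝ) ^ P.d := by have := P.L_pos; positivity
  have hswap : ∀ c : PBond P (j + 1),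
      ∑ r : Pt P, ∑ t ∈ Finset.range P.L, dist1 (V (segBond c r t))
        = ∑ t ∈ Finset.range P.L, ∑ r : Pt P, dist1 (V (segBond c r t)) := fun c => Finset.sum_comm
  rw [← Finset.mul_sum, tv_one_eq, card_pt, theta]
  have hmain : ∑ c : PBond P (j + 1), ∑ r : Pt P, segMass₁ V c r ≤ (P.L : ℝ) * ∑ b : PBond P j, dist1 (V b) := by
    calc ∑ c : PBond P (j + 1), ∑ r : Pt P, segMass₁ V c r
        = ∑ c : PBond P (j + 1), ∑ r : Pt P, ∑ t ∈ Finset.range P.L, dist1 (V (segBond c r t)) :=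
          Finset.sum_congr rfl fun c _ => Finset.sum_congr rfl fun r _ => walkMass_seg_eq V c r
      _ = ∑ t ∈ Finset.range P.L, ∑ c : PBond P (j + 1), ∑ r : Pt P, dist1 (V (segBond c r t)) := by
          rw [Finset.sum_congr rfl fun c _ => hswap c, Finset.sum_comm]
      _ ≤ ∑ _t ∈ Finset.range P.L, ∑ b : PBond P j, dist1 (V b) :=
          Finset.sum_le_sum fun t _ => sum_segBond_le hj t (fun b => dist1 (V b)) fun _ => GaugeGroup.dist1_nonneg _
      _ = (P.L : ℝ) * ∑ b : PBond P j, dist1 (V b) := by rw [Finset.sum_const, Finset.card_range, nsmul_eq_mul]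
  calc ((P.L : ℝ) ^ P.d)⁻¹ * ∑ c : PBond P (j + 1), ∑ r : Pt P, segMass₁ V c r
      ≤ ((P.L : ℝ) ^ P.d)⁻¹ * ((P.L : ℝ) * ∑ b : PBond P j, dist1 (V b)) := mul_le_mul_of_nonneg_left hmain (inv_nonneg.mpr hL.le)
    _ = (P.L : ℝ) * ((P.L : ℝ) ^ P.d)⁻¹ * ∑ b : PBond P j, dist1 (V b) := by ring

/-- THE REMAINDER MASSES of the two-level estimate double-count each fine bond boundedly: `Σ_c rem₂(V,c) ≤ 14·d·|S_d|·ℓ·tv(1,V)`. [folklore] -/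
theorem sum_rem₂_le (hj : j + 1 ≤ P.m + P.K) (V : GaugeField P j (Matrix.specialUnitaryGroup n ℂ)) :
    ∑ c : PBond P (j + 1), rem₂ V c ≤ 14 * P.d * Dn P * ell P * tv 1 V := by
  have hℓ : (0 : ℝ) ≤ ell P := Nat.cast_nonneg _
  have hD := one_le_Dn P
  have hlen_stair : ∀ (σ : Equiv.Perm (Fin P.d)) (r : Pt P), ((stairWord σ (off r)).length : ℝ) ≤ ell P := fun σ r => by
    have h := length_stairWord_le (P := P) σ r
    have : P.d * P.L ≤ ell P := by unfold ell; nlinarith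
    exact_mod_cast h.trans this
  -- staircases at y live in B(y)
  have hstair1 : ∀ (y : Site P (j + 1)) (σ : Equiv.Perm (Fin P.d)) (r : Pt P),
      walkMass V (walk (emb y) (stairWord σ (off r))) ≤ ell P * (blockSum V y + blockSum V y) := fun y σ r => by
    refine (walkMass_le_of_support V (y := y) (y' := y) _
      fun s hs => Or.inl (blockOf_ends_of_mem_stairWalk hj y r σ s hs).1).trans ?_
    rw [length_walk]
    exact mul_le_mul_of_nonneg_right (hlen_stair σ r) (add_nonneg (blockSum_nonneg V _) (blockSum_nonneg V _))
  have hsM : ∀ y : Site P (j + 1), stairMass₂ V y ≤ 2 * ell P * blockSum V y := fun y => by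
    have h : stairMass₂ V y ≤ ell P * (blockSum V y + blockSum V y) :=
      mean_le_of_le (ι := PI P) (a := fun p : PI P => walkMass V (walk (emb y) (stairWord p.2 (off p.1))))
        fun p => hstair1 y p.2 p.1
    linarith
  have hpM : ∀ (y : Site P (j + 1)) (r : Pt P), permMass V y r ≤ Dn P * (2 * ell P * blockSum V y) := fun y r => by
    unfold permMass Dn
    calc ∑ σ : Equiv.Perm (Fin P.d), walkMass V (walk (emb y) (stairWord σ (off r)))
        ≤ ∑ _σ : Equiv.Perm (Fin P.d), 2 * ell P * blockSum V y := Finset.sum_le_sum fun σ _ => (hstair1 y σ r).trans (by linarith)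
      _ = Fintype.card (Equiv.Perm (Fin P.d)) * (2 * ell P * blockSum V y) := by rw [Finset.sum_const, Finset.card_univ, nsmul_eq_mul]
  have hseg : ∀ (c : PBond P (j + 1)) (r : Pt P), segMass₁ V c r ≤ ell P * (blockSum V c.src + blockSum V c.tgt) := fun c r => by
    refine (walkMass_le_of_support V _ (blockOf_src_of_mem_segWalk hj c ⟨r, 1, 1⟩)).trans ?_
    refine mul_le_mul_of_nonneg_right ?_ (add_nonneg (blockSum_nonneg V _) (blockSum_nonneg V _))
    rw [length_walk, List.length_replicate]
    have : P.L ≤ ell P := by unfold ell; nlinarith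
    exact_mod_cast this
  have hax : ∀ c : PBond P (j + 1), axMass V c ≤ ell P * (blockSum V c.src + blockSum V c.tgt) := fun c => by
    refine (walkMass_le_of_support V _ (blockOf_src_of_mem_axWalk hj c)).trans ?_
    refine mul_le_mul_of_nonneg_right ?_ (add_nonneg (blockSum_nonneg V _) (blockSum_nonneg V _))
    rw [length_walk, List.length_replicate]
    have : P.L ≤ ell P := by unfold ell; nlinarith
    exact_mod_cast this
  have hlRM : ∀ c : PBond P (j + 1), loopRemMean V c ≤ (2 * Dn P + 2) * ell P * (blockSum V c.src + blockSum V c.tgt) := fun c => by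
    refine (mean_le_of_le fun r => ?_)
    have h1 := hpM c.src r; have h2 := hseg c r; have h3 := hpM c.tgt r; have h4 := hax c
    unfold loopRem₂
    linarith
  have hsrc := sum_blockSum_le V (fun c : PBond P (j + 1) => c.src) injective_src_dir
  have htgt := sum_blockSum_le V (fun c : PBond P (j + 1) => c.tgt) injective_tgt_dir
  calc ∑ c : PBond P (j + 1), rem₂ V c
      ≤ ∑ c : PBond P (j + 1), (2 * Dn P + 5) * ell P * (blockSum V c.src + blockSum V c.tgt) :=
        Finset.sum_le_sum fun c _ => by
          have := hsM c.src; have := hlRM c; have := hax c; have := hsM c.tgt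
          rw [rem₂]
          linarith
    _ = (2 * Dn P + 5) * ell P * (∑ c : PBond P (j + 1), blockSum V c.src + ∑ c : PBond P (j + 1), blockSum V c.tgt) := by
        rw [← Finset.mul_sum, Finset.sum_add_distrib]
    _ ≤ (2 * Dn P + 5) * ell P * (P.d * tv 1 V + P.d * tv 1 V) := by gcongr
    _ ≤ 14 * P.d * Dn P * ell P * tv 1 V := by
        have ht := tv_nonneg (1 : GaugeField P j (Matrix.specialUnitaryGroup n ℂ)) V
        have hd : (0 : ℝ) ≤ P.d := Nat.cast_nonneg _
        have hx : ell P * (P.d * tv 1 V) ≤ Dn P * (ell P * (P.d * tv 1 V)) :=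
          le_mul_of_one_le_left (mul_nonneg hℓ (mul_nonneg hd ht)) hD
        have e1 : (2 * Dn P + 5) * ell P * (P.d * tv 1 V + P.d * tv 1 V)
            = 4 * (Dn P * (ell P * (P.d * tv 1 V))) + 10 * (ell P * (P.d * tv 1 V)) := by ring
        have e2 : 14 * P.d * Dn P * ell P * tv 1 V = 14 * (Dn P * (ell P * (P.d * tv 1 V))) := by ring
        rw [e1, e2]
        linarith

/-- `K₂ = 46956·d·|S_d|²·ℓ²`: the coefficient of the radius in the two-level contraction factor. [folklore] -/
def K2 (P : Params) : ℝ := 46956 * P.d * Dn P ^ 2 * (ell P : ℝ) ^ 2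

/-- **THE FRAMED ONE-STEP CONTRACTION FROM THE FLAT CONFIGURATION, TWO-LEVEL PRESCRIPTION**: `tv(1, F₂(V)) ≤ (θ + K₂ρ)·tv(1,V)`. [folklore] -/
theorem tv_framed₂_le (hj : j + 1 ≤ P.m + P.K) (V : GaugeField P j (Matrix.specialUnitaryGroup n ℂ)) {ρ : ℝ}
    (hρ : 0 ≤ ρ) (hV : ∀ b, dist1 (V b) ≤ ρ) (hF : 2 * (ell P * ρ) < deltaFed n) (hδ : 12 * Dn P * (ell P * ρ) < deltaSU n)
    (h2 : 12 * Dn P * (ell P * ρ) ≤ 1 / 2) :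
    tv 1 (framed₂ V) ≤ (theta P + K2 P * ρ) * tv 1 V := by
  rw [tv_one_eq (framed₂ V)]
  have hD := one_le_Dn P
  have hη0 : 0 ≤ 3354 * Dn P * (ell P * ρ) := by positivity
  calc ∑ c : PBond P (j + 1), dist1 (framed₂ V c)
      ≤ ∑ c : PBond P (j + 1), ((Fintype.card (Pt P) : ℝ)⁻¹ * ∑ r : Pt P, segMass₁ V c r + 3354 * Dn P * (ell P * ρ) * rem₂ V c) :=
        Finset.sum_le_sum fun c _ => dist1_framed₂_le hj V hρ hV hF hδ h2 c
    _ = ∑ c : PBond P (j + 1), (Fintype.card (Pt P) : ℝ)⁻¹ * ∑ r : Pt P, segMass₁ V c r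
          + 3354 * Dn P * (ell P * ρ) * ∑ c : PBond P (j + 1), rem₂ V c := by
        rw [Finset.sum_add_distrib, Finset.mul_sum]
    _ ≤ theta P * tv 1 V + 3354 * Dn P * (ell P * ρ) * (14 * P.d * Dn P * ell P * tv 1 V) :=
        add_le_add (sum_mean_segMass₁_le hj V) (mul_le_mul_of_nonneg_left (sum_rem₂_le hj V) hη0)
    _ = (theta P + K2 P * ρ) * tv 1 V := by rw [K2]; ring

/-! ## §2 The shrinking sup-ball domains of the two-level analysis -/

/-- `ρ⋆₂ = min(min(δ_Fed/(4ℓ), δ_N/(48|S_d|ℓ)), θ/(2K₂))`. [folklore] -/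
def radStar₂ (P : Params) (n : Type*) [Fintype n] : ℝ :=
  min (min (deltaFed n / (4 * ell P)) (deltaSU n / (48 * Dn P * ell P))) (theta P / (2 * K2 P))

/-- `ρ⁽²⁾_j = ρ⋆₂·(71|S_d|ℓ)^{−(m+K−j)}`. [folklore] -/
def rad₂ (P : Params) (n : Type*) [Fintype n] (j : ℕ) : ℝ := radStar₂ P n * ((71 * Dn P * ell P : ℝ)⁻¹) ^ (P.m + P.K - j)

/-- THE DOMAIN FAMILY of the two-level analysis. [folklore] -/
def dom₂ (P : Params) (n : Type*) [Fintype n] [DecidableEq n] [Nonempty n] (j : ℕ) :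
    Set (GaugeField P j (Matrix.specialUnitaryGroup n ℂ)) :=
  {V | ∀ b, dist1 (V b) ≤ rad₂ P n j}

/-- `0 < K₂`. [folklore] -/
theorem K2_pos (P : Params) : 0 < K2 P := by
  have := P.hd; have := ell_pos P; have := one_le_Dn P
  unfold K2; positivity

/-- `0 < ρ⋆₂`. [folklore] -/
theorem radStar₂_pos (P : Params) (n : Type*) [Fintype n] [Nonempty n] : 0 < radStar₂ P n := by
  have := ell_pos P; have := one_le_Dn P; have := K2_pos P; have := theta_pos P
  have h1 : 0 < deltaFed n := deltaFed_pos
  have h2 : 0 < deltaSU n := deltaSU_pos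
  unfold radStar₂
  exact lt_min (lt_min (by positivity) (by positivity)) (by positivity)

/-- `1 ≤ 71|S_d|ℓ` and `0 < 71|S_d|ℓ`. [folklore] -/
theorem ratio₂_bounds (P : Params) : (2 : ℝ) ≤ 71 * Dn P * ell P := by
  have := one_le_ell P; have := one_le_Dn P; nlinarith

/-- `0 ≤ ρ⁽²⁾_j ≤ ρ⋆₂`. [folklore] -/
theorem rad₂_bounds (P : Params) (n : Type*) [Fintype n] [Nonempty n] (j : ℕ) : 0 ≤ rad₂ P n j ∧ rad₂ P n j ≤ radStar₂ P n := by
  have hr := ratio₂_bounds P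
  have hq0 : (0 : ℝ) ≤ (71 * Dn P * ell P)⁻¹ := inv_nonneg.mpr (by linarith)
  have hq1 : (71 * Dn P * ell P : ℝ)⁻¹ ≤ 1 := by rw [inv_le_one_iff₀]; right; linarith
  exact ⟨mul_nonneg (radStar₂_pos P n).le (pow_nonneg hq0 _),
    mul_le_of_le_one_right (radStar₂_pos P n).le (pow_le_one₀ hq0 hq1)⟩

/-- The guards on the domains: `2ℓρ_j < δ_Fed`, `12|S_d|ℓρ_j < δ_N`, `12|S_d|ℓρ_j ≤ ½`. [folklore] -/
theorem guards₂ (P : Params) (n : Type*) [Fintype n] [Nonempty n] (j : ℕ) :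
    2 * (ell P * rad₂ P n j) < deltaFed n ∧ 12 * Dn P * (ell P * rad₂ P n j) < deltaSU n ∧ 12 * Dn P * (ell P * rad₂ P n j) ≤ 1 / 2 := by
  have hℓ := ell_pos P; have hD := one_le_Dn P
  have h1 : 0 < deltaFed n := deltaFed_pos
  have h2 : 0 < deltaSU n := deltaSU_pos
  have h3 : deltaSU n ≤ 1 / 3 := min_le_left _ _
  obtain ⟨hr0, hr⟩ := rad₂_bounds P n j
  have ha : rad₂ P n j ≤ deltaFed n / (4 * ell P) := hr.trans ((min_le_left _ _).trans (min_le_left _ _))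
  have hb : rad₂ P n j ≤ deltaSU n / (48 * Dn P * ell P) := hr.trans ((min_le_left _ _).trans (min_le_right _ _))
  have ha' : ell P * rad₂ P n j ≤ deltaFed n / 4 := by
    calc ell P * rad₂ P n j ≤ ell P * (deltaFed n / (4 * ell P)) := mul_le_mul_of_nonneg_left ha hℓ.le
      _ = deltaFed n / 4 := by field_simp
  have hb' : 12 * Dn P * (ell P * rad₂ P n j) ≤ deltaSU n / 4 := by
    calc 12 * Dn P * (ell P * rad₂ P n j) ≤ 12 * Dn P * (ell P * (deltaSU n / (48 * Dn P * ell P))) := by gcongr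
      _ = deltaSU n / 4 := by field_simp; ring
  exact ⟨by linarith, by linarith, by linarith⟩

/-- `ρ⁽²⁾_{j+1} = 71|S_d|ℓ·ρ⁽²⁾_j` in the standing range. [folklore] -/
theorem rad₂_succ (P : Params) (n : Type*) [Fintype n] {j : ℕ} (hj : j + 1 ≤ P.m + P.K) :
    rad₂ P n (j + 1) = 71 * Dn P * ell P * rad₂ P n j := by
  have hℓ : (71 * Dn P * ell P : ℝ) ≠ 0 := by have := ratio₂_bounds P; linarith
  have he : P.m + P.K - j = (P.m + P.K - (j + 1)) + 1 := by omega
  have hq : (71 * Dn P * ell P : ℝ) * (71 * Dn P * ell P : ℝ)⁻¹ = 1 := mul_inv_cancel₀ hℓ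
  unfold rad₂
  rw [he, pow_succ]
  linear_combination (-(radStar₂ P n * ((71 * Dn P * ell P : ℝ)⁻¹) ^ (P.m + P.K - (j + 1)))) * hq

/-- The trivial configuration is in every domain. [folklore] -/
theorem one_mem_dom₂ (j : ℕ) : (1 : GaugeField P j (Matrix.specialUnitaryGroup n ℂ)) ∈ dom₂ P n j := fun b => by
  rw [show (1 : GaugeField P j (Matrix.specialUnitaryGroup n ℂ)) b = 1 from rfl, GaugeGroup.dist1_one]
  exact (rad₂_bounds P n j).1

/-! ## §3 The tower for the two-level prescription -/

/-- **`FlatStepContraction` FOR THE TWO-LEVEL PRESCRIPTION ON `SU(N)`** with factors `θ + K₂ρ⁽²⁾_j`. [folklore] -/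
theorem flatStepContraction_blockAvg₂SU :
    FlatStepContraction (fun j => (blockAvg₂ (federbushSU (n := n)) (expMeanLogSU (n := n)) :
      Averaging P j (Matrix.specialUnitaryGroup n ℂ))) (dom₂ P n) (fun j => theta P + K2 P * rad₂ P n j) := by
  intro j hj V hV
  obtain ⟨hF, hδ, h2⟩ := guards₂ P n j
  have hρ := (rad₂_bounds P n j).1
  refine ⟨frameTransf₂ V, fun c => ?_, ?_⟩
  · show dist1 (framed₂ V c) ≤ rad₂ P n (j + 1)
    rw [rad₂_succ P n hj]
    have := dist1_framed₂_le_sup V hρ hV hF hδ h2 c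
    linarith
  · show tv 1 (framed₂ V) ≤ (theta P + K2 P * rad₂ P n j) * tv 1 V
    exact tv_framed₂_le hj V hρ hV hF hδ h2

/-- THE RADII SUM TO AT MOST `ρ⋆₂` along any stretch of levels. [folklore] -/
theorem sum_rad₂_le (P : Params) (n : Type*) [Fintype n] [Nonempty n] {k n' : ℕ} (hkn : k + n' ≤ P.m + P.K) :
    ∑ i ∈ range n', rad₂ P n (k + i) ≤ radStar₂ P n := by
  have hr := ratio₂_bounds P
  set q : ℝ := (71 * Dn P * ell P : ℝ)⁻¹ with hq
  have hq0 : 0 ≤ q := inv_nonneg.mpr (by linarith)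
  have hq1 : q ≤ 1 := by rw [hq, inv_le_one_iff₀]; right; linarith
  have hq2 : 2 * q ≤ 1 := by
    rw [hq]
    calc 2 * (71 * Dn P * ell P : ℝ)⁻¹ = 2 / (71 * Dn P * ell P) := by ring
      _ ≤ 1 := by rw [div_le_one (by linarith)]; exact hr
  have hsum : ∑ i ∈ range n', rad₂ P n (k + i) = radStar₂ P n * ∑ i ∈ range n', q ^ ((P.m + P.K - k) - i) := by
    rw [Finset.mul_sum]
    refine Finset.sum_congr rfl fun i _ => ?_
    unfold rad₂
    rw [Nat.sub_sub]
  rw [hsum]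
  refine mul_le_of_le_one_right (radStar₂_pos P n).le ?_
  refine (geomTail_le hq0 hq2 (P.m + P.K - k) n' (by omega)).trans ?_
  calc 2 * q ^ (P.m + P.K - k - n' + 1) = (2 * q) * q ^ (P.m + P.K - k - n') := by ring
    _ ≤ 1 * 1 := mul_le_mul hq2 (pow_le_one₀ hq0 hq1) (pow_nonneg hq0 _) zero_le_one
    _ = 1 := by ring

/-- THE LEVEL FACTORS COMPOSE TO `e·θⁿ`. [folklore] -/
theorem prod_factor₂_le (P : Params) (n : Type*) [Fintype n] [Nonempty n] {k n' : ℕ} (hkn : k + n' ≤ P.m + P.K) :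
    ∏ i ∈ range n', (theta P + K2 P * rad₂ P n (k + i)) ≤ Real.exp 1 * theta P ^ n' := by
  have hθ := theta_pos P
  have hK := K2_pos P
  have hfac : ∀ i ∈ range n', theta P + K2 P * rad₂ P n (k + i) ≤ theta P * Real.exp (K2 P / theta P * rad₂ P n (k + i)) := by
    intro i _
    have h1 := Real.add_one_le_exp (K2 P / theta P * rad₂ P n (k + i))
    have hθinv : theta P * (theta P)⁻¹ = 1 := mul_inv_cancel₀ hθ.ne'
    have e : theta P * (K2 P / theta P * rad₂ P n (k + i) + 1) = theta P + K2 P * rad₂ P n (k + i) := by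
      rw [div_eq_mul_inv]
      linear_combination (K2 P * rad₂ P n (k + i)) * hθinv
    calc theta P + K2 P * rad₂ P n (k + i) = theta P * (K2 P / theta P * rad₂ P n (k + i) + 1) := e.symm
      _ ≤ theta P * Real.exp (K2 P / theta P * rad₂ P n (k + i)) := mul_le_mul_of_nonneg_left h1 hθ.le
  have hpos : ∀ i ∈ range n', 0 ≤ theta P + K2 P * rad₂ P n (k + i) := fun i _ =>
    add_nonneg hθ.le (mul_nonneg hK.le (rad₂_bounds P n _).1)
  have hsum : ∑ i ∈ range n', K2 P / theta P * rad₂ P n (k + i) ≤ 1 := by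
    rw [← Finset.mul_sum]
    calc K2 P / theta P * ∑ i ∈ range n', rad₂ P n (k + i) ≤ K2 P / theta P * radStar₂ P n :=
          mul_le_mul_of_nonneg_left (sum_rad₂_le P n hkn) (by positivity)
      _ ≤ K2 P / theta P * (theta P / (2 * K2 P)) := mul_le_mul_of_nonneg_left (min_le_right _ _) (by positivity)
      _ = 1 / 2 := by
          rw [div_mul_div_comm, div_eq_iff (by positivity)]
          ring
      _ ≤ 1 := by norm_num
  calc ∏ i ∈ range n', (theta P + K2 P * rad₂ P n (k + i))
      ≤ ∏ i ∈ range n', theta P * Real.exp (K2 P / theta P * rad₂ P n (k + i)) := Finset.prod_le_prod hpos hfac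
    _ = theta P ^ n' * Real.exp (∑ i ∈ range n', K2 P / theta P * rad₂ P n (k + i)) := by
        rw [Finset.prod_mul_distrib, Finset.prod_const, Finset.card_range, Real.exp_sum]
    _ ≤ theta P ^ n' * Real.exp 1 := by gcongr
    _ = Real.exp 1 * theta P ^ n' := mul_comm _ _

/-- **`BondDevBound (blockAvg₂ federbushSU expMeanLogSU) dom₂ e θ`** — for the TWO-LEVEL printed prescription on `SU(N)`. [folklore] -/
theorem bondDevBound_blockAvg₂SU :
    BondDevBound (fun j => (blockAvg₂ (federbushSU (n := n)) (expMeanLogSU (n := n)) :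
      Averaging P j (Matrix.specialUnitaryGroup n ℂ))) (dom₂ P n) (Real.exp 1) (theta P) :=
  bondDevBound_of_flatStepContraction flatStepContraction_blockAvg₂SU
    (fun j => add_nonneg (theta_nonneg P) (mul_nonneg (K2_pos P).le (rad₂_bounds P n j).1))
    fun _ _ hkn => prod_factor₂_le P n hkn

/-- **`HolDevBound (blockAvg₂ federbushSU expMeanLogSU) dom₂ e θ`**. [folklore] -/
theorem holDevBound_blockAvg₂SU :
    HolDevBound (fun j => (blockAvg₂ (federbushSU (n := n)) (expMeanLogSU (n := n)) :
      Averaging P j (Matrix.specialUnitaryGroup n ℂ))) (dom₂ P n) (Real.exp 1) (theta P) :=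
  holDevBound_of_bondDevBound bondDevBound_blockAvg₂SU

/-- **`LoopDefectBound (blockAvg₂ federbushSU expMeanLogSU) dom₂ (e²/2) θ`** (criticality on `SU(N)`). [folklore] -/
theorem loopDefectBound_blockAvg₂SU :
    LoopDefectBound (fun j => (blockAvg₂ (federbushSU (n := n)) (expMeanLogSU (n := n)) :
      Averaging P j (Matrix.specialUnitaryGroup n ℂ))) (dom₂ P n) (1 / 2 * Real.exp 1 ^ 2) (theta P) :=
  loopDefectBound_of_holDevBound reTrCrit_specialUnitaryGroup (by norm_num) holDevBound_blockAvg₂SU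

end SUN

/-! ## §4 The headline's printed class, BOTH disjuncts -/

section Headline

open Literature.MathematicalPhysics.QuantumFieldTheory.Balaban1983to89.T4Continuum.FiniteEpsData

variable {F : T4Family} {N : ℕ} [NeZero N]

/-- For data in the TWO-LEVEL printed class (`D.IsPrintedAveraged₂`), `HolDevBound` for the datum's own averaging maps. [folklore] -/
theorem holDevBound_of_isPrintedAveraged₂ (D : FiniteEpsData F (Matrix.specialUnitaryGroup (Fin N) ℂ)) (hD : D.IsPrintedAveraged₂)
    (K : ℕ) : HolDevBound (D.av K) (dom₂ (F.P K) (Fin N)) (Real.exp 1) (theta (F.P K)) := by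
  have h : D.av K = fun j => blockAvg₂ (federbushSU (n := Fin N)) (expMeanLogSU (n := Fin N)) := funext fun j => hD K j
  rw [h]
  exact holDevBound_blockAvg₂SU

/-- THE COMMON DOMAIN FAMILY for the two printed prescriptions: the intersection of the two sup-ball families (again sup-balls, the
smaller radius at each level). [folklore] -/
def domPrinted (P : Params) (n : Type*) [Fintype n] [DecidableEq n] [Nonempty n] (j : ℕ) :
    Set (GaugeField P j (Matrix.specialUnitaryGroup n ℂ)) :=
  dom P n j ∩ dom₂ P n j

/-- **NODE S's HOLONOMY-LEVEL INPUT FOR THE HEADLINE'S CLASS, BOTH DISJUNCTS**: for every finite-`ε` datum `D` over `SU(N)` with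
`D.IsPrintedAveraged` — the exact hypothesis `hD` of `T4ContinuumYM4Torus.continuumYM4_torus_of_BetaPertH` ([Balaban1987RG1] (0.4) OR
(0.10)–(0.12) with the printed means) — and every cutoff `K`, `HolDevBound (D.av K) domPrinted e θ`, `θ = L^{1−d}`: the closed-walk
holonomies of the datum's own `n`-fold averages of a domain configuration are within `e·|w|·θⁿ·tv(1,V)` of the identity. [folklore] -/
theorem holDevBound_of_isPrintedAveraged (D : FiniteEpsData F (Matrix.specialUnitaryGroup (Fin N) ℂ)) (hD : D.IsPrintedAveraged)
    (K : ℕ) : HolDevBound (D.av K) (domPrinted (F.P K) (Fin N)) (Real.exp 1) (theta (F.P K)) := by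
  rcases hD with h1 | h2
  · exact (holDevBound_of_isPrintedAveraged₁ D h1 K).anti fun j => Set.inter_subset_left
  · exact (holDevBound_of_isPrintedAveraged₂ D h2 K).anti fun j => Set.inter_subset_right

/-- … and generation 3's `LoopDefectBound` (constant `e²/2`) for the datum's own averaging maps, for the whole printed class. [folklore] -/
theorem loopDefectBound_of_isPrintedAveraged (D : FiniteEpsData F (Matrix.specialUnitaryGroup (Fin N) ℂ)) (hD : D.IsPrintedAveraged)
    (K : ℕ) : LoopDefectBound (D.av K) (domPrinted (F.P K) (Fin N)) (1 / 2 * Real.exp 1 ^ 2) (theta (F.P K)) :=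
  loopDefectBound_of_holDevBound reTrCrit_specialUnitaryGroup (by norm_num) (holDevBound_of_isPrintedAveraged D hD K)

/-- The trivial configuration is in every common domain (non-vacuity of the binder `1 ∈ dom` of the shapes). [folklore] -/
theorem one_mem_domPrinted {P : Params} {n : Type*} [Fintype n] [DecidableEq n] [Nonempty n] (j : ℕ) :
    (1 : GaugeField P j (Matrix.specialUnitaryGroup n ℂ)) ∈ domPrinted P n j :=
  ⟨one_mem_dom j, one_mem_dom₂ j⟩

end Headline

end Summit.QuantumFields.BalabanUV.T4Continuum.Spine.NE7

end
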